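/-
Copyright (c) 2026 the pub-hodgecm-mathlib formalisation cell (harness21).  Prover seat hodgecm-mathlib-LD1-p02 (g2), line LD1
(`Cruxes/HLiu418/Lines/F0_P6LD_StubS1FactsThetaRoad`, organ (L) «line pin», brick (L-T1) packaged for the seam), 2026-09-02.  KERNEL module:
THEOREMS ONLY (no definition, no named fact, no instance, no notation, no `sorry`).
-/
import Literature.NumberTheory.Automorphic.Liu2021.ThetaLiftFromLineSeamFrameTransport
import Literature.NumberTheory.GelbartRogawski1991.DoubledWeilRepresentationGramTransport
import Literature.NumberTheory.Automorphic.UnitaryGroupLevelTransport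
import HarnessLib

-- As in the lineage (`ThetaLiftFromLineSeamTransport`, `ThetaLiftFromLineSeamFrameTransport`): statements over the theta-kernel datum
-- and the doubled Weil machinery elaborate to very large types; elaborate sequentially.
set_option Elab.async false

/-!
# The seam `MeetsThetaLiftFromLine` under the W-RESCALING `(c • d_V, ⟨a⟩) ≡ (d_V, ⟨c·a⟩)` (brick (L-T1⁺) of LD1 organ (L))

Topic `NumberTheory/Automorphic/Liu2021`; namespace `Literature.NumberTheory.Automorphic.Liu2021` (§2–§3) and
`Literature.NumberTheory.Automorphic.Liu2021.Def411WeilCarriersDoubling` (§1).  THEOREMS ONLY.  Sequel of ★ `ThetaLiftFromLineSeamTransport`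
(§2 `MeetsThetaLiftFromLine.transport`), ★ `ThetaLiftFromLineSeamFrameTransport` (§3 bridge `omega_pairSplitting_chiSplittingLine`, §4
`MeetsThetaLiftFromLine.frameTransport`) and ★ `GelbartRogawski1991/DoubledWeilRepresentationGramTransport` (`omega_chiSplitting_eq_of_gramDA_eq`), whose
module docstring announces this file («the line-level packaging (the seam transport (L-T1) for `MeetsThetaLiftFromLine`) is the sequel
`Liu2021/ThetaLiftFromLineSeamRescale`»).  Cell hodgecm-mathlib FLOOR 0, crux `HLiu418` (stmt-HodgeConjecture-24832), LD1 in-house θ-road, organ (L)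
`ThetaLinePinned₂`, hypothesis `hLT` of ★ `Theorems/F0LD1ThetaLinePinnedOfBricks` («a seam from the line `⟨a″⟩` transports to a seam from `⟨a₁⟩` when
`a₁ ∕ a″` is a local norm everywhere and totally positive»).

[Liu2021, App. D §D.1 Step 1, footnote l. 5215]: «the isomorphism class of `ω(μ, ε, χ)` depends only on `(μ, ε, χ)`».  For a scalar `c ∈ (L⁺)^×`
the index data `(c • d_V, ⟨a⟩)` and `(d_V, ⟨c · a⟩)` have THE SAME Kronecker Gram matrix `(c d_V) ⊗ (a) = d_V ⊗ (c a)`, hence the same symplectic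
model `𝒮(𝔸^{n})`, the same adelic unitary groups AS MATRIX GROUPS (`U(c • J)(𝔸) = U(J)(𝔸)`, ★ `unitaryGroupOfForm_smul_of_isUnit`), and — by the
uniqueness of the `χ`-normalised doubled Weil representation, ★ `omega_chiSplitting_eq_of_gramDA_eq` — THE SAME Weil operators at the `χ`-splittings.
THIS FILE feeds that identity to ★ `MeetsThetaLiftFromLine.transport` with `R := id`, `θ_V`, `θ_W` the identity retypings:

* §1 bookkeeping: the frames `c • d_V`, the lines `⟨c · a⟩` (`JW (c·a) = c • JW a`), the equal adelic ∕ rational unitary groups, the identity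
  retypings `θ_V`, `θ_W`, `θ_pair`, `θ^𝔻` (all the identity on matrices, continuous), the Gram identity `gramR (c • d_V) (a) = gramR d_V (c · a)`.
* §2 **`MeetsThetaLiftFromLine.rescale`** — for every `c ∈ (L⁺)^×` and line `⟨a⟩`:
  `MeetsThetaLiftFromLine … (c • d_V) … P μ hμ a ιA′ → MeetsThetaLiftFromLine … d_V … P μ hμ (c · a) (θ_V ∘ ιA′)` (given Weil's majorants at the
  target, as in `frameTransport`), `θ_V : U(diag (c • d_V))(𝔸) →* U(diag d_V)(𝔸)` the identity on matrices (`coe_frameRetype`).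

HONEST SCOPE.  Nothing of [Liu2021] is asserted; no new letter; no positivity or norm hypothesis on `c` is needed HERE (the operator identity is
formal); the local–global input (Hasse for `L ∕ L⁺`, ★ `CMFieldHasseNorm`) and the scalar isometry `d_V ↦ c • d_V` (★ `frameTransport` at `B = e • 1`,
`c = e ē`) are the CONSUMER's (`Theorems/F0LD1LineTransportOfKits`).  HC_CM is proved only modulo the printed citations (2 remaining named inputs hLiu418
24832, h413 24833) until rung 0 closes; count-neutral.

## References
* [Liu2021] Y. Liu, Camb. J. Math. 9 (2021) = arXiv:2102.11518, Def. 4.11 (l. 2092–2096); App. D §D.1 Step 1 (footnote l. 5215); Thm. B.4 (2) p. 98;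
  proof of Cor. B.6 (3) p. 99 L41–46.
* [GelbartRogawski1991] S. Gelbart, J. Rogawski, Invent. Math. 105 (1991), §3.1 Prop. 3.1.1 p. 455 L1–2, Remark p. 457; §3.2 p. 457.
* [Kudla1994] S. Kudla, Israel J. Math. 87 (1994), §2, Thm. 3.1 (uniqueness of the normalised doubled Weil representation).
* [Weil1964] A. Weil, Acta Math. 111 (1964), Chap. III n° 41, Thm. 6 p. 193.
* [PlatonovRapinchuk1994] V. Platonov, A. Rapinchuk (1994), §2.3 (the unitary group of a form depends only on its similarity class).
-/

set_option autoImplicit false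

noncomputable section

open NumberField MeasureTheory IsDedekindDomain
open scoped Matrix Kronecker ComplexOrder ENNReal

/-! ## §1 Bookkeeping: the rescaled frame, the rescaled line, the identity retypings, the Gram identity -/

namespace Literature.NumberTheory.Automorphic.Liu2021.Def411WeilCarriersDoubling

open _root_.MeasureTheory
open Literature.NumberTheory.Automorphic Literature.NumberTheory.Automorphic.UnitaryGroup
open Literature.NumberTheory.Automorphic.Liu2021.Def411WeilCarriers
open Literature.NumberTheory.GelbartRogawski1991 Literature.NumberTheory.GelbartRogawski1991.UnitaryDualPair
open Literature.NumberTheory.GelbartRogawski1991.GRConstruction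
open Literature.NumberTheory.Weil1964
open Literature.NumberTheory.GaloisRepresentations
open Literature.RepresentationTheory.HarrisKudlaSweet1996
open Literature.RepresentationTheory.HeisenbergGroup

section Rescale

variable (L : Type) [Field L] [NumberField L] [IsCMField L] {N : ℕ}

omit [IsCMField L] in
/-- `(t • H)_𝔸 = t_𝔸 • H_𝔸` (the form read over the adeles). [cite: PlatonovRapinchuk1994, §5.1] -/
theorem adelicForm_smul (t : L) (H : Matrix (Fin N) (Fin N) L) :
    UnitaryGroup.adelicForm L N (t • H) = algebraMap L (AdeleRing (𝓞 L) L) t • UnitaryGroup.adelicForm L N H := by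
  ext i j
  simp [UnitaryGroup.adelicForm, Matrix.map_apply, Matrix.smul_apply, map_mul, smul_eq_mul]

/-- **`U(t • H)(𝔸_{L⁺}) = U(H)(𝔸_{L⁺})`** for `t ≠ 0`: the unitary group of a form depends only on its similarity class (adelic twin of ★
`UnitaryGroup.finAdelic_smul` ∕ `rational_smul`). [cite: PlatonovRapinchuk1994, §2.3] -/
theorem adelic_smul (H : Matrix (Fin N) (Fin N) L) {t : L} (ht : t ≠ 0) :
    UnitaryGroup.adelic (Fp L) L (IsCMField.complexConj L) N (t • H) = UnitaryGroup.adelic (Fp L) L (IsCMField.complexConj L) N H := by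
  change unitaryGroupOfForm _ (UnitaryGroup.adelicForm L N (t • H)) = unitaryGroupOfForm _ (UnitaryGroup.adelicForm L N H)
  rw [adelicForm_smul]
  exact unitaryGroupOfForm_smul_of_isUnit _ ((IsUnit.mk0 t ht).map _) _

variable (dV : Fin N → L) (c a : (Fp L)ˣ)

omit [NumberField L] [IsCMField L] in
/-- the scalar `c ∈ (L⁺)^×` read in `L` is non-zero. [folklore] -/
private theorem coe_units_ne_zero : ((c : Fp L) : L) ≠ 0 := by
  exact_mod_cast c.ne_zero

/-- the rescaled frame `c • d_V` is real. [cite: Liu2021, App. D §D.1 Step 1 (footnote l. 5215)] -/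
theorem complexConj_smul_frame (hdV : ∀ i, IsCMField.complexConj L (dV i) = dV i) (i : Fin N) :
    IsCMField.complexConj L ((((c : Fp L) : L) * dV i)) = ((c : Fp L) : L) * dV i := by
  rw [map_mul, hdV i, (IsCMField.complexConj_eq_self_iff (K := L) _).2 (c : Fp L).2]

omit [NumberField L] [IsCMField L] in
/-- the rescaled frame `c • d_V` is non-degenerate. [cite: Liu2021, App. D §D.1 Step 1 (footnote l. 5215)] -/
theorem smul_frame_ne_zero (hdV0 : ∀ i, dV i ≠ 0) (i : Fin N) : ((c : Fp L) : L) * dV i ≠ 0 :=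
  mul_ne_zero (coe_units_ne_zero L c) (hdV0 i)

omit [NumberField L] in
/-- `diag (c • d_V) = c • diag d_V`. [folklore] -/
private theorem diagonal_smul_frame :
    Matrix.diagonal (fun i => ((c : Fp L) : L) * dV i) = ((c : Fp L) : L) • Matrix.diagonal dV := by
  rw [← Matrix.diagonal_smul]; rfl

omit [NumberField L] [IsCMField L] in
/-- `J_{⟨c·a⟩} = c • J_{⟨a⟩}` (`JW a = (a) ⊗ 1`). [cite: Liu2021, App. D §D.1 Step 1 (l. 5215)] -/
theorem JW_mul : JW (Fp L) L (c * a) = ((c : Fp L) : L) • JW (Fp L) L a := by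
  ext i j
  obtain rfl : i = 0 := Subsingleton.elim _ _
  obtain rfl : j = 0 := Subsingleton.elim _ _
  simp [JW, TW, Matrix.map_apply, Matrix.smul_apply, Units.val_mul]
  rfl

/-- **`U(diag (c • d_V))(𝔸) = U(diag d_V)(𝔸)`** as subgroups of `GL_N(𝔸_L)`. [cite: PlatonovRapinchuk1994, §2.3] -/
theorem adelic_diagonal_smul_frame :
    UnitaryGroup.adelic (Fp L) L (IsCMField.complexConj L) N (Matrix.diagonal fun i => ((c : Fp L) : L) * dV i) =
      UnitaryGroup.adelic (Fp L) L (IsCMField.complexConj L) N (Matrix.diagonal dV) := by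
  rw [diagonal_smul_frame]
  exact adelic_smul L _ (coe_units_ne_zero L c)

/-- **`U(⟨c·a⟩)(𝔸) = U(⟨a⟩)(𝔸)`** as subgroups of `GL₁(𝔸_L)`. [cite: PlatonovRapinchuk1994, §2.3] -/
theorem adelic_JW_mul :
    UnitaryGroup.adelic (Fp L) L (IsCMField.complexConj L) 1 (JW (Fp L) L (c * a)) =
      UnitaryGroup.adelic (Fp L) L (IsCMField.complexConj L) 1 (JW (Fp L) L a) := by
  rw [JW_mul]
  exact adelic_smul L _ (coe_units_ne_zero L c)

/-- **`U(⟨c·a⟩)(L⁺) = U(⟨a⟩)(L⁺)`** as subgroups of `GL₁(L)` (★ `rational_smul`). [cite: PlatonovRapinchuk1994, §2.3] -/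
theorem rational_JW_mul :
    UnitaryGroup.rational (Fp L) L (IsCMField.complexConj L) 1 (JW (Fp L) L (c * a)) =
      UnitaryGroup.rational (Fp L) L (IsCMField.complexConj L) 1 (JW (Fp L) L a) := by
  rw [JW_mul]
  exact UnitaryGroup.rational_smul (Fp L) L (IsCMField.complexConj L) 1 (coe_units_ne_zero L c) _

/-! ### the identity retypings `θ_V`, `θ_W` (identity on matrices, bicontinuous) -/

/-- **`θ_V : U(diag (c • d_V))(𝔸) →* U(diag d_V)(𝔸)`**, the identity on matrices. [cite: PlatonovRapinchuk1994, §2.3] -/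
theorem coe_frameRetype (k : UnitaryGroup.adelic (Fp L) L (IsCMField.complexConj L) N (Matrix.diagonal fun i => ((c : Fp L) : L) * dV i)) :
    (((MulEquiv.subgroupCongr (adelic_diagonal_smul_frame L dV c)) k :
        UnitaryGroup.adelic (Fp L) L (IsCMField.complexConj L) N (Matrix.diagonal dV)) : GL (Fin N) (AdeleRing (𝓞 L) L)) =
      (k : GL (Fin N) (AdeleRing (𝓞 L) L)) :=
  MulEquiv.subgroupCongr_apply _ _

/-- **`θ_W : U(⟨a⟩)(𝔸) ≃* U(⟨c·a⟩)(𝔸)`**, the identity on matrices. [cite: PlatonovRapinchuk1994, §2.3] -/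
theorem coe_lineRetype (u : UnitaryGroup.adelic (Fp L) L (IsCMField.complexConj L) 1 (JW (Fp L) L a)) :
    (((MulEquiv.subgroupCongr (adelic_JW_mul L c a).symm) u :
        UnitaryGroup.adelic (Fp L) L (IsCMField.complexConj L) 1 (JW (Fp L) L (c * a))) : GL (Fin 1) (AdeleRing (𝓞 L) L)) =
      (u : GL (Fin 1) (AdeleRing (𝓞 L) L)) :=
  MulEquiv.subgroupCongr_symm_apply (adelic_JW_mul L c a) u

omit [IsCMField L] in
/-- a retyping along an equality of subgroups of `GL_M(𝔸_L)` is continuous. [folklore] -/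
private theorem continuous_subgroupCongr {M : ℕ} {S₁ S₂ : Subgroup (GL (Fin M) (AdeleRing (𝓞 L) L))} (h : S₁ = S₂) :
    Continuous (MulEquiv.subgroupCongr h) := by
  subst h
  exact continuous_id

omit [IsCMField L] in
/-- the inverse retyping is continuous. [folklore] -/
private theorem continuous_subgroupCongr_symm {M : ℕ} {S₁ S₂ : Subgroup (GL (Fin M) (AdeleRing (𝓞 L) L))} (h : S₁ = S₂) :
    Continuous (MulEquiv.subgroupCongr h).symm := by
  subst h
  exact continuous_id

/-- `θ_W` maps `U(⟨a⟩)(L⁺)` onto `U(⟨c·a⟩)(L⁺)` (same matrices, ★ `rational_smul`). [cite: PlatonovRapinchuk1994, §2.3] -/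
theorem map_lineRetype_range_toAdelic :
    ((UnitaryGroup.toAdelic (Fp L) L (IsCMField.complexConj L) 1 (JW (Fp L) L a)).range).map
        ((MulEquiv.subgroupCongr (adelic_JW_mul L c a).symm :
            UnitaryGroup.adelic (Fp L) L (IsCMField.complexConj L) 1 (JW (Fp L) L a) ≃*
              UnitaryGroup.adelic (Fp L) L (IsCMField.complexConj L) 1 (JW (Fp L) L (c * a))) :
          UnitaryGroup.adelic (Fp L) L (IsCMField.complexConj L) 1 (JW (Fp L) L a) →*
            UnitaryGroup.adelic (Fp L) L (IsCMField.complexConj L) 1 (JW (Fp L) L (c * a))) =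
      (UnitaryGroup.toAdelic (Fp L) L (IsCMField.complexConj L) 1 (JW (Fp L) L (c * a))).range := by
  ext x
  simp only [Subgroup.mem_map, MonoidHom.mem_range]
  constructor
  · rintro ⟨y, ⟨r, rfl⟩, rfl⟩
    refine ⟨MulEquiv.subgroupCongr (rational_JW_mul L c a).symm r, Subtype.ext ?_⟩
    rw [MonoidHom.coe_coe, MulEquiv.subgroupCongr_apply]
    change Matrix.GeneralLinearGroup.map (algebraMap L (AdeleRing (𝓞 L) L))
        ((MulEquiv.subgroupCongr (rational_JW_mul L c a).symm r :
          UnitaryGroup.rational (Fp L) L (IsCMField.complexConj L) 1 (JW (Fp L) L (c * a))) : GL (Fin 1) L) =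
      Matrix.GeneralLinearGroup.map (algebraMap L (AdeleRing (𝓞 L) L)) (r : GL (Fin 1) L)
    rw [MulEquiv.subgroupCongr_apply]
  · rintro ⟨r, rfl⟩
    refine ⟨UnitaryGroup.toAdelic (Fp L) L (IsCMField.complexConj L) 1 (JW (Fp L) L a) (MulEquiv.subgroupCongr (rational_JW_mul L c a) r),
      ⟨_, rfl⟩, Subtype.ext ?_⟩
    rw [MonoidHom.coe_coe, MulEquiv.subgroupCongr_apply]
    change Matrix.GeneralLinearGroup.map (algebraMap L (AdeleRing (𝓞 L) L))
        ((MulEquiv.subgroupCongr (rational_JW_mul L c a) r :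
          UnitaryGroup.rational (Fp L) L (IsCMField.complexConj L) 1 (JW (Fp L) L a)) : GL (Fin 1) L) =
      Matrix.GeneralLinearGroup.map (algebraMap L (AdeleRing (𝓞 L) L)) (r : GL (Fin 1) L)
    rw [MulEquiv.subgroupCongr_apply]

/-! ### the Gram identity and the doubled ∕ pair retypings -/

/-- `realDiag (c • d_V) = c • realDiag d_V` over `L⁺`. [folklore] -/
private theorem realDiagonal_smul_frame (hdV : ∀ i, IsCMField.complexConj L (dV i) = dV i) :
    realDiagonal L (fun i => ((c : Fp L) : L) * dV i) (complexConj_smul_frame L dV c hdV) = (c : Fp L) • realDiagonal L dV hdV := by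
  ext i j
  simp only [realDiagonal, Matrix.smul_apply, Matrix.diagonal_apply]
  simp only [smul_eq_mul, mul_ite, mul_zero]
  split_ifs
  · rfl
  · rfl

omit [NumberField L] [IsCMField L] in
/-- `T_{⟨c·a⟩} = c • T_{⟨a⟩}`. [cite: Liu2021, App. D §D.1 Step 1 (l. 5215)] -/
theorem TW_mul : TW (Fp L) (c * a) = (c : Fp L) • TW (Fp L) a := by
  ext i j
  obtain rfl : i = 0 := Subsingleton.elim _ _
  obtain rfl : j = 0 := Subsingleton.elim _ _
  simp [TW, Units.val_mul]

/-- **THE GRAM IDENTITY `d_V ⊗ (c·a) = (c • d_V) ⊗ (a)`** — the two index data have the same rational Kronecker Gram matrix.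
[cite: GelbartRogawski1991, §3.1 Prop. 3.1.1 p. 455 L1–2] [cite: Liu2021, App. D §D.1 Step 1 (footnote l. 5215)] -/
theorem gramR_rescale {n₂ : ℕ} (e₁ : Fin N × Fin 1 ≃ Fin n₂) (hdV : ∀ i, IsCMField.complexConj L (dV i) = dV i) :
    gramR L e₁ dV hdV (lineW L (TW (Fp L) (c * a))) (complexConj_lineW L (TW (Fp L) (c * a))) =
      gramR L e₁ (fun i => ((c : Fp L) : L) * dV i) (complexConj_smul_frame L dV c hdV) (lineW L (TW (Fp L) a))
        (complexConj_lineW L (TW (Fp L) a)) := by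
  simp only [GRConstruction.gramR, UnitaryDualPair.gram, realDiagonal_lineW, TW_mul, Matrix.kronecker_smul]
  rw [realDiagonal_smul_frame L dV c hdV, Matrix.smul_kronecker]

omit [NumberField L] [IsCMField L] in
/-- `diag (lineW T_{⟨c·a⟩}) = c • diag (lineW T_{⟨a⟩})` over `L`. [cite: Liu2021, App. D §D.1 Step 1 (l. 5215)] -/
theorem diagonal_lineW_mul :
    Matrix.diagonal (lineW L (TW (Fp L) (c * a))) = ((c : Fp L) : L) • Matrix.diagonal (lineW L (TW (Fp L) a)) := by
  rw [diagonal_lineW L (TW (Fp L) (c * a)) (JW_eq (Fp L) L (c * a)), diagonal_lineW L (TW (Fp L) a) (JW_eq (Fp L) L a), JW_mul]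

/-- **`U(diag (c • d_V) ⊗ (a))(𝔸) = U(diag d_V ⊗ (c·a))(𝔸)`** — the big unitary groups of the two pairs coincide as subgroups of `GL_{N·1}(𝔸_L)`
(same Kronecker form). [cite: GelbartRogawski1991, §3.2 p. 457] -/
theorem adelicPair_rescale :
    UnitaryGroup.adelicPair (Fp L) L (IsCMField.complexConj L) N 1 (Matrix.diagonal fun i => ((c : Fp L) : L) * dV i)
        (Matrix.diagonal (lineW L (TW (Fp L) a))) =
      UnitaryGroup.adelicPair (Fp L) L (IsCMField.complexConj L) N 1 (Matrix.diagonal dV)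
        (Matrix.diagonal (lineW L (TW (Fp L) (c * a)))) := by
  unfold UnitaryGroup.adelicPair
  rw [diagonal_smul_frame, diagonal_lineW_mul, adelicForm_smul, adelicForm_smul, Matrix.smul_kronecker, Matrix.kronecker_smul]

end Rescale

end Literature.NumberTheory.Automorphic.Liu2021.Def411WeilCarriersDoubling

/-! ## §2 The seam under the W-rescaling `(c • d_V, ⟨a⟩) ≡ (d_V, ⟨c·a⟩)` -/

namespace Literature.NumberTheory.Automorphic.Liu2021

open _root_.MeasureTheory
open Literature.NumberTheory.Automorphic Literature.NumberTheory.Automorphic.UnitaryGroup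
open Literature.NumberTheory.Automorphic.UnitaryGroup.CotangentForms
open Literature.NumberTheory.Automorphic.IdeleClassGroup
open Literature.NumberTheory.Automorphic.Liu2021.Def411WeilCarriers
open Literature.NumberTheory.Automorphic.Liu2021.Def411WeilCarriersDoubling
open Literature.NumberTheory.GelbartRogawski1991 Literature.NumberTheory.GelbartRogawski1991.UnitaryDualPair
open Literature.NumberTheory.GelbartRogawski1991.GRConstruction
open Literature.NumberTheory.Weil1964
open Literature.NumberTheory.GaloisRepresentations
open Literature.RepresentationTheory.HarrisKudlaSweet1996
open Literature.RepresentationTheory.Liu2021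
open Literature.RepresentationTheory.HeisenbergGroup

section Rescale

variable (L : Type) [Field L] [NumberField L] [IsCMField L] (N : ℕ) (H : Matrix (Fin N) (Fin N) L)
  {n₂ : ℕ} (e₁ : Fin N × Fin 1 ≃ Fin n₂)
  (dV : Fin N → L) (hdV : ∀ i, IsCMField.complexConj L (dV i) = dV i) (hdV0 : ∀ i, dV i ≠ 0)
  {μA : Measure (adelicGroupData (↥(maximalRealSubfield L)) L (IsCMField.complexConj L) N H).automorphicQuotient}
  [(adelicGroupData (↥(maximalRealSubfield L)) L (IsCMField.complexConj L) N H).IsAutomorphicMeasure μA]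
  (μ : Literature.NumberTheory.Automorphic.IdeleClassGroup L →ₜ* Circle) (hμ : IsConjugateSymplectic L μ)
  (c a : (↥(maximalRealSubfield L))ˣ)

set_option maxHeartbeats 800000 in
-- (two pair telescopes)
/-- the retyping `θ_pair` of the pair element `(k ⊗ 1)(1 ⊗ ũ)` at the source is the pair element `(θ_V k ⊗ 1)(1 ⊗ θ_W u~)` at the target
(same matrices). [cite: GelbartRogawski1991, §3.2 p. 457] -/
theorem pairRetype_adelicInl_mul_adelicInr
    (k : ↥(UnitaryGroup.adelic (Fp L) L (IsCMField.complexConj L) N (Matrix.diagonal fun i => ((c : Fp L) : L) * dV i)))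
    (u : ↥(UnitaryGroup.adelic (Fp L) L (IsCMField.complexConj L) 1 (JW (Fp L) L a))) :
    (MulEquiv.subgroupCongr (adelicPair_rescale L dV c a)).toMonoidHom
        (adelicInl (Fp L) L (IsCMField.complexConj L) N 1 (Matrix.diagonal fun i => ((c : Fp L) : L) * dV i)
            (Matrix.diagonal (lineW L (TW (Fp L) a))) k *
          adelicInr (Fp L) L (IsCMField.complexConj L) N 1 (Matrix.diagonal fun i => ((c : Fp L) : L) * dV i)
            (Matrix.diagonal (lineW L (TW (Fp L) a)))
            ((MulEquiv.subgroupCongr (congrArg (UnitaryGroup.adelic (Fp L) L (IsCMField.complexConj L) 1)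
              (diagonal_lineW L (TW (Fp L) a) (JW_eq (Fp L) L a)))).symm u)) =
        adelicInl (Fp L) L (IsCMField.complexConj L) N 1 (Matrix.diagonal dV) (Matrix.diagonal (lineW L (TW (Fp L) (c * a))))
            ((MulEquiv.subgroupCongr (adelic_diagonal_smul_frame L dV c)).toMonoidHom k) *
          adelicInr (Fp L) L (IsCMField.complexConj L) N 1 (Matrix.diagonal dV) (Matrix.diagonal (lineW L (TW (Fp L) (c * a))))
            ((MulEquiv.subgroupCongr (congrArg (UnitaryGroup.adelic (Fp L) L (IsCMField.complexConj L) 1)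
              (diagonal_lineW L (TW (Fp L) (c * a)) (JW_eq (Fp L) L (c * a))))).symm
              ((MulEquiv.subgroupCongr (adelic_JW_mul L c a).symm) u)) := by
  apply Subtype.ext
  rw [MulEquiv.coe_toMonoidHom, MulEquiv.subgroupCongr_apply, Subgroup.coe_mul, Subgroup.coe_mul]
  show kroneckerGL ((k : GL (Fin N) (AdeleRing (𝓞 L) L)), (1 : GL (Fin 1) (AdeleRing (𝓞 L) L))) *
      kroneckerGL ((1 : GL (Fin N) (AdeleRing (𝓞 L) L)),
        (((MulEquiv.subgroupCongr (congrArg (UnitaryGroup.adelic (Fp L) L (IsCMField.complexConj L) 1)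
            (diagonal_lineW L (TW (Fp L) a) (JW_eq (Fp L) L a)))).symm u :
          ↥(UnitaryGroup.adelic (Fp L) L (IsCMField.complexConj L) 1 (Matrix.diagonal (lineW L (TW (Fp L) a))))) :
            GL (Fin 1) (AdeleRing (𝓞 L) L))) =
    kroneckerGL ((((MulEquiv.subgroupCongr (adelic_diagonal_smul_frame L dV c)).toMonoidHom k :
          ↥(UnitaryGroup.adelic (Fp L) L (IsCMField.complexConj L) N (Matrix.diagonal dV))) : GL (Fin N) (AdeleRing (𝓞 L) L)),
        (1 : GL (Fin 1) (AdeleRing (𝓞 L) L))) *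
      kroneckerGL ((1 : GL (Fin N) (AdeleRing (𝓞 L) L)),
        (((MulEquiv.subgroupCongr (congrArg (UnitaryGroup.adelic (Fp L) L (IsCMField.complexConj L) 1)
            (diagonal_lineW L (TW (Fp L) (c * a)) (JW_eq (Fp L) L (c * a))))).symm
            ((MulEquiv.subgroupCongr (adelic_JW_mul L c a).symm) u) :
          ↥(UnitaryGroup.adelic (Fp L) L (IsCMField.complexConj L) 1 (Matrix.diagonal (lineW L (TW (Fp L) (c * a)))))) :
            GL (Fin 1) (AdeleRing (𝓞 L) L)))
  rw [MulEquiv.coe_toMonoidHom, MulEquiv.subgroupCongr_apply, MulEquiv.subgroupCongr_symm_apply, MulEquiv.subgroupCongr_symm_apply,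
    MulEquiv.subgroupCongr_apply]

set_option maxHeartbeats 1600000 in
-- (telescopes of both index data)
/-- **THE PAIR REPRESENTATIONS OF `(c • d_V, ⟨a⟩)` AND `(d_V, ⟨c·a⟩)` AT THE `μ`-ATTACHED SPLITTINGS HAVE THE SAME WEIL OPERATORS**:
`ω′(s′(k, u)) = ω(s(θ_V k, θ_W u))` on `𝒮(𝔸^{n})` — ★ `omega_chiSplitting_eq_of_gramDA_eq` (equal Kronecker Gram, uniqueness of the normalised doubled
Weil representation) read at the line through ★ `omega_pairSplitting_chiSplittingLine`.
[cite: GelbartRogawski1991, §3.1 Prop. 3.1.1 p. 455 L1–2; §3.2 p. 457] [cite: Kudla1994, §3 Thm. 3.1] [cite: Liu2021, App. D §D.1 Step 1 (footnote l. 5215)] -/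
theorem pairRep_rescale
    (k : ↥(UnitaryGroup.adelic (Fp L) L (IsCMField.complexConj L) N (Matrix.diagonal fun i => ((c : Fp L) : L) * dV i)))
    (u : ↥(UnitaryGroup.adelic (Fp L) L (IsCMField.complexConj L) 1 (JW (Fp L) L a))) (Φ : piSchwartzBruhat (Fp L) (Fin n₂)) :
    pairRep (Fp L) L (IsCMField.complexConj L) N 1 e₁ (Matrix.diagonal fun i => ((c : Fp L) : L) * dV i) (JW (Fp L) L a)
        (chiSplittingLine L e₁ (fun i => ((c : Fp L) : L) * dV i) (complexConj_smul_frame L dV c hdV) (smul_frame_ne_zero L dV c hdV0)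
          (toHeckeCharacter L μ) (isUnitary_toHeckeCharacter L μ) ((isOscillatorChar_toHeckeCharacter_iff μ).mpr hμ) (TW (Fp L) a)
          (isUnit_det_TW (Fp L) a) (JW (Fp L) L a) (JW_eq (Fp L) L a))
        (k, u) Φ =
      pairRep (Fp L) L (IsCMField.complexConj L) N 1 e₁ (Matrix.diagonal dV) (JW (Fp L) L (c * a))
        (chiSplittingLine L e₁ dV hdV hdV0 (toHeckeCharacter L μ) (isUnitary_toHeckeCharacter L μ)
          ((isOscillatorChar_toHeckeCharacter_iff μ).mpr hμ) (TW (Fp L) (c * a)) (isUnit_det_TW (Fp L) (c * a)) (JW (Fp L) L (c * a))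
          (JW_eq (Fp L) L (c * a)))
        ((MulEquiv.subgroupCongr (adelic_diagonal_smul_frame L dV c)).toMonoidHom k,
          (MulEquiv.subgroupCongr (adelic_JW_mul L c a).symm) u) Φ := by
  have hG := gramR_rescale L dV c a e₁ hdV
  -- the two pair representations read in the model (★ bridge)
  have h1 := omega_pairSplitting_chiSplittingLine L e₁ (fun i => ((c : Fp L) : L) * dV i) (complexConj_smul_frame L dV c hdV)
    (smul_frame_ne_zero L dV c hdV0) (toHeckeCharacter L μ) (isUnitary_toHeckeCharacter L μ) ((isOscillatorChar_toHeckeCharacter_iff μ).mpr hμ)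
    (TW (Fp L) a) (isUnit_det_TW (Fp L) a) (JW (Fp L) L a) (JW_eq (Fp L) L a) k u Φ
  have h2 := omega_pairSplitting_chiSplittingLine L e₁ dV hdV hdV0 (toHeckeCharacter L μ) (isUnitary_toHeckeCharacter L μ)
    ((isOscillatorChar_toHeckeCharacter_iff μ).mpr hμ) (TW (Fp L) (c * a)) (isUnit_det_TW (Fp L) (c * a)) (JW (Fp L) L (c * a))
    (JW_eq (Fp L) L (c * a)) ((MulEquiv.subgroupCongr (adelic_diagonal_smul_frame L dV c)).toMonoidHom k)
    ((MulEquiv.subgroupCongr (adelic_JW_mul L c a).symm) u) Φ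
  -- the (L-T1) operator identity at the pair element `(k ⊗ 1)(1 ⊗ ũ)`
  have h3 := omega_chiSplitting_eq_of_gramDA_eq (hdV₁0 := hdV0)
    (hdW₁0 := lineW_ne_zero L (TW (Fp L) (c * a)) (isUnit_det_TW (Fp L) (c * a)))
    (hdV₂0 := smul_frame_ne_zero L dV c hdV0) (hdW₂0 := lineW_ne_zero L (TW (Fp L) a) (isUnit_det_TW (Fp L) a))
    (gramDA_mul_one_of_gramR_eq hG)
    (θ := (MulEquiv.subgroupCongr (HA_eq_of_gramR_eq hG)).toMonoidHom) (fun x => MulEquiv.subgroupCongr_apply _ x)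
    (continuous_subgroupCongr L (HA_eq_of_gramR_eq hG))
    (θG := (MulEquiv.subgroupCongr (adelicPair_rescale L dV c a)).toMonoidHom) (fun g => MulEquiv.subgroupCongr_apply _ g)
    (toHeckeCharacter L μ) (isUnitary_toHeckeCharacter L μ) ((isOscillatorChar_toHeckeCharacter_iff μ).mpr hμ)
    (adelicInl (Fp L) L (IsCMField.complexConj L) N 1 (Matrix.diagonal fun i => ((c : Fp L) : L) * dV i)
        (Matrix.diagonal (lineW L (TW (Fp L) a))) k *
      adelicInr (Fp L) L (IsCMField.complexConj L) N 1 (Matrix.diagonal fun i => ((c : Fp L) : L) * dV i)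
        (Matrix.diagonal (lineW L (TW (Fp L) a)))
        ((MulEquiv.subgroupCongr (congrArg (UnitaryGroup.adelic (Fp L) L (IsCMField.complexConj L) 1)
          (diagonal_lineW L (TW (Fp L) a) (JW_eq (Fp L) L a)))).symm u)) Φ
  -- `θ_pair (k ⊗ 1 · 1 ⊗ ũ) = θ_V k ⊗ 1 · 1 ⊗ ũ′` inside the (L-T1) identity
  have h3' := ((congrArg (fun x => adelicMpCont.omega (Fp L) (Fin n₂)
      (gramA L e₁ dV hdV (lineW L (TW (Fp L) (c * a))) (complexConj_lineW L (TW (Fp L) (c * a))))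
      (chiSplitting L e₁ dV hdV hdV0 (lineW L (TW (Fp L) (c * a))) (complexConj_lineW L (TW (Fp L) (c * a)))
        (lineW_ne_zero L (TW (Fp L) (c * a)) (isUnit_det_TW (Fp L) (c * a))) (toHeckeCharacter L μ) (isUnitary_toHeckeCharacter L μ)
        ((isOscillatorChar_toHeckeCharacter_iff μ).mpr hμ) x) Φ) (pairRetype_adelicInl_mul_adelicInr L N dV c a k u)).symm.trans h3)
  -- source: `pairRep′ (k, u) Φ = ω(s_χ[src](k ⊗ 1 · 1 ⊗ ũ)) Φ`
  have hA := (pairRep_apply (Fp L) L (IsCMField.complexConj L) N 1 e₁ (Matrix.diagonal fun i => ((c : Fp L) : L) * dV i) (JW (Fp L) L a)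
    (chiSplittingLine L e₁ (fun i => ((c : Fp L) : L) * dV i) (complexConj_smul_frame L dV c hdV) (smul_frame_ne_zero L dV c hdV0)
      (toHeckeCharacter L μ) (isUnitary_toHeckeCharacter L μ) ((isOscillatorChar_toHeckeCharacter_iff μ).mpr hμ) (TW (Fp L) a)
      (isUnit_det_TW (Fp L) a) (JW (Fp L) L a) (JW_eq (Fp L) L a)) (k, u) Φ).trans h1
  -- target: `pairRep (θ_V k, θ_W u) Φ = ω(s_χ[tgt](θ_V k ⊗ 1 · 1 ⊗ ũ′)) Φ`
  have hB := (pairRep_apply (Fp L) L (IsCMField.complexConj L) N 1 e₁ (Matrix.diagonal dV) (JW (Fp L) L (c * a))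
    (chiSplittingLine L e₁ dV hdV hdV0 (toHeckeCharacter L μ) (isUnitary_toHeckeCharacter L μ)
      ((isOscillatorChar_toHeckeCharacter_iff μ).mpr hμ) (TW (Fp L) (c * a)) (isUnit_det_TW (Fp L) (c * a)) (JW (Fp L) L (c * a))
      (JW_eq (Fp L) L (c * a)))
    ((MulEquiv.subgroupCongr (adelic_diagonal_smul_frame L dV c)).toMonoidHom k, (MulEquiv.subgroupCongr (adelic_JW_mul L c a).symm) u)
    Φ).trans h2
  exact hA.trans (h3'.symm.trans hB.symm)

set_option maxHeartbeats 1600000 in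
-- (telescopes of both index data; measured on the lineage: fails at the default)
/-- **THE SEAM UNDER THE W-RESCALING** (brick (L-T1⁺)).  For every scalar `c ∈ (L⁺)^×` and every line `⟨a⟩`: if `P` meets the theta lift
from `⟨a⟩` in the frame `c • d_V` along `ιA′`, it meets the theta lift from `⟨c · a⟩` in the frame `d_V` along `θ_V ∘ ιA′`, `θ_V` the identity
retyping `U(diag (c • d_V))(𝔸) = U(diag d_V)(𝔸)` (`coe_frameRetype`).  PROOF = ★ `MeetsThetaLiftFromLine.transport` at `θ_V`, `θ_W` the identity
retypings, `R := id` (so `Θ ∘ R = Θ` trivially), the operator identity being ★ `omega_chiSplitting_eq_of_gramDA_eq` (the `χ`-normalised doubled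
Weil representation depends on the frames only through the Kronecker Gram `(c d_V) ⊗ (a) = d_V ⊗ (c a)`, [Kudla1994, Thm. 3.1] uniqueness) read at
the line through ★ `omega_pairSplitting_chiSplittingLine`.
[cite: Liu2021, Def. 4.11 (l. 2092–2096); App. D §D.1 Step 1 (footnote l. 5215); proof of Cor. B.6 (3) p. 99 L41–46]
[cite: GelbartRogawski1991, §3.1 Prop. 3.1.1 p. 455 L1–2, Remark p. 457] [cite: Kudla1994, §2, Thm. 3.1] [cite: Weil1964, Chap. III n° 41 Thm 6 p. 193] -/
theorem MeetsThetaLiftFromLine.rescale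
    (hρ : HasThetaMajorants fun
      (p : ↥(UnitaryGroup.adelic (↥(maximalRealSubfield L)) L (IsCMField.complexConj L) N (Matrix.diagonal dV)) ×
        ↥(UnitaryGroup.adelic (↥(maximalRealSubfield L)) L (IsCMField.complexConj L) 1 (JW (↥(maximalRealSubfield L)) L (c * a))))
      (Φ : piSchwartzBruhat (↥(maximalRealSubfield L)) (Fin n₂)) =>
        pairRep (↥(maximalRealSubfield L)) L (IsCMField.complexConj L) N 1 e₁ (Matrix.diagonal dV) (JW (↥(maximalRealSubfield L)) L (c * a))
          (chiSplittingLine L e₁ dV hdV hdV0 (toHeckeCharacter L μ) (isUnitary_toHeckeCharacter L μ)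
            ((isOscillatorChar_toHeckeCharacter_iff μ).mpr hμ) (TW (↥(maximalRealSubfield L)) (c * a))
            (isUnit_det_TW (↥(maximalRealSubfield L)) (c * a)) (JW (↥(maximalRealSubfield L)) L (c * a))
            (JW_eq (↥(maximalRealSubfield L)) L (c * a))) p Φ)
    [CompactSpace (↥(UnitaryGroup.adelic (↥(maximalRealSubfield L)) L (IsCMField.complexConj L) N
        (Matrix.diagonal fun i => ((c : ↥(maximalRealSubfield L)) : L) * dV i)) ⧸
      (UnitaryGroup.toAdelic (↥(maximalRealSubfield L)) L (IsCMField.complexConj L) N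
        (Matrix.diagonal fun i => ((c : ↥(maximalRealSubfield L)) : L) * dV i)).range)]
    [CompactSpace (↥(UnitaryGroup.adelic (↥(maximalRealSubfield L)) L (IsCMField.complexConj L) N (Matrix.diagonal dV)) ⧸
      (UnitaryGroup.toAdelic (↥(maximalRealSubfield L)) L (IsCMField.complexConj L) N (Matrix.diagonal dV)).range)]
    (P : DiscreteAutomorphicRep (adelicGroupData (↥(maximalRealSubfield L)) L (IsCMField.complexConj L) N H) μA)
    (ιA' : (adelicGroupData (↥(maximalRealSubfield L)) L (IsCMField.complexConj L) N H).Adelic →*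
      ↥(UnitaryGroup.adelic (↥(maximalRealSubfield L)) L (IsCMField.complexConj L) N
        (Matrix.diagonal fun i => ((c : ↥(maximalRealSubfield L)) : L) * dV i)))
    (h : MeetsThetaLiftFromLine L N H e₁ (fun i => ((c : ↥(maximalRealSubfield L)) : L) * dV i)
      (complexConj_smul_frame L dV c hdV) (smul_frame_ne_zero L dV c hdV0) P μ hμ a ιA') :
    MeetsThetaLiftFromLine L N H e₁ dV hdV hdV0 P μ hμ (c * a)
      ((MulEquiv.subgroupCongr (adelic_diagonal_smul_frame L dV c)).toMonoidHom.comp ιA') := by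
  exact MeetsThetaLiftFromLine.transport L N H e₁ e₁ (fun i => ((c : Fp L) : L) * dV i) (complexConj_smul_frame L dV c hdV)
    (smul_frame_ne_zero L dV c hdV0) dV hdV hdV0 μ hμ a (c * a) (MulEquiv.subgroupCongr (adelic_diagonal_smul_frame L dV c)).toMonoidHom
    (MulEquiv.subgroupCongr (adelic_JW_mul L c a).symm) (continuous_subgroupCongr L _) (continuous_subgroupCongr_symm L _)
    (map_lineRetype_range_toAdelic L c a) LinearMap.id (fun _ => rfl) (fun k u Φ => pairRep_rescale L N e₁ dV hdV hdV0 μ hμ c a k u Φ) hρ P ιA' h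

end Rescale

end Literature.NumberTheory.Automorphic.Liu2021

end
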